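import Literature.IUT.HodgeTheaters.GenuineFKitMergeInputs
import Literature.IUT.HodgeTheaters.GenuineFKitMergeInputsSlots
import Literature.IUT.HodgeTheaters.GenuineFKitOfBadLocal
import Literature.IUT.HodgeTheaters.InitialThetaDataLocalGroupsProofs
import Literature.IUT.HodgeTheaters.InitialThetaDataLocalSlim
import Literature.IUT.HodgeTheaters.InitialThetaDataDecompositionCharacters
import HarnessLib

/-!
# [IUTchI] Cor 5.3 (ii) / Def 5.2 (i): THE (S1) UPGRADE OF RECORD — the lift-kind `ℱ`-slot of the genuine `ℱ`-prime-strip kit at a good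
# nonarchimedean index over the GENUINE `𝒞_v̲` (racer C's `frobeniusGoodAt`), and the model case of Cor 5.3 (ii) there READ OUT
# (L5 base-merge race, racer B FILE 3 «Assembly»; L5-lead RULINGS #117 (1)(3b): «B's LiftKind = the (S1) upgrade of record»)

S. Mochizuki, *Inter-universal Teichmüller theory I*, kurims manuscript (May 2020), §5 Corollary 5.3 (ii) p. 144 («the natural map
`Isom(¹𝔉, ²𝔉) → Isom(¹𝔇, ²𝔇)` is bijective»; its printed proof p. 144 l. 33–36 «follows immediately from [AbsTopIII], Proposition 3.2,
(iv); 4.2, (i)») and the argument PRINTED FOR (iv), p. 144 l. 37 – p. 145 l. 8 («surjectivity follows immediately from the construction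
… it remains to verify injectivity … over the identity self-equivalence of `𝒟_v`»), whose two-halves SHAPE is transposed here to the (ii)
slot (doc-only v2, referee defect F-S15-2: those lines belong to the proof of (iv), not of (ii)), Definition 5.2 (i) p. 134 («`‡ℱ_v` is a category `‡𝒞_v` which admits an equivalence of categories `‡𝒞_v ⥲ 𝒞_v` [where `𝒞_v`
is as in Examples 3.2, (iii); 3.3, (i)]»), Example 3.3 (i) p. 78 («`𝒟_v := ℬ(X̲→_v)⁰` … `ℱ̲_v := 𝒞_v`»), Definition 3.1 (e)(f) pp. 62–63
(«natural injections of profinite groups … `Π_v̲ := Π_{X̲→_v̲} ⊆ Π_{X̲→_K}`») ([IUTchI] Cor 5.3 (ii) p.144) [claim: Mochizuki2012, status: disputed]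
(D-0012 claim key, series status DISPUTED — a CONSTRUCTION over abc-iut's own kit of record and PROOF-ONLY read-outs; nothing of the series
is asserted; no side is taken on [IUTchIII] Cor. 3.12).  Also [cite: MochizukiFrdII2008, Ex 1.3 (ii) p.11] (transport of small coset
categories along continuous homomorphisms).

## What this file builds (cell abc-iut; the `--supports` sequel on the WINNER's term per RACE RULES (b) / RULINGS #117)

Racer C (abc-iut-L5-t2) won the L5 base-merge race with `InitialThetaData.genuineFKitOfBadLocal` (p496697): the genuine `ℱ`-prime-strip
kit over abc-iut-w5-d129's kit of record `baseKitThetaNFOfBadPairs`, whose `ℱ`-slots have the ADMISSIBLE-FOR-THE-TERM shape σ3 («tagged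
isomorph, `toD` fully faithful» — a tautology for Cor 5.3, never a token carrier).  L5-lead RULINGS #117 (1)(3b) fixed racer B's LIFT KIND
(`GenuineFKitMergeInputs` p495677: `CatIsomorphism.liftSubgroup/liftKindToAmb`, read-out `mapIso_liftKindToAmb_bijective_iff`) with its
`ρ` (`GenuineFKitMergeInputsSlots` p496979: `InitialThetaData.modelAutToCatAut`) as THE (S1) UPGRADE OF RECORD.  This file assembles it AT
THE TERM:
* §0 `CatIsomorphism.rigidOverBase_comp_equivalence_iff` — the injectivity half `RigidOverBase` is invariant under post-composing the
  structure functor with an equivalence of bases (so the half read at a transported structure functor is the one at `toBase` itself);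
* §1 `InitialThetaData.piLocEquiv` (the EXPLICIT `Π_{(−)} ×_{G_F} Γ ≃* Π_{(−)} ∩ augGF⁻¹(ρ(Γ))` inside abc-iut-L5-t2's
  `nonempty_mulEquiv_PiLoc_inf`), `continuous_piLocEquiv(_symm)` (a homeomorphism: compact source by abc-iut-L5-t2 `compactSpace_PiLoc`,
  Hausdorff target), `cosetCatPiLocEquiv : CosetCat Π_{(−)_v̲} ≌ CosetCat ↥(Π_{(−)} ∩ augGF⁻¹(ρ(Γ)))` (racer B `PiTransport.pullEquivOfInverse`);
* §2 GENERIC in the place data `(p, k, ι, hinj, hX)` and the seam equation `hG`: `goodBaseEquiv`, `goodStructureFunctor` (`toBase` of abc-iut-L5-t2's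
  `D.goodLocalFrobenioidOfEmb p k ι hX` read over the kit's embedded `Π_v̲`), `goodLiftSubgroup`, `GoodLiftFAmb` (= `FAmb x`), `goodLiftToD`
  (= `toD x`, `goodLiftToD_obj` rfl ⇒ (S5) `toD_model x := Iso.refl _`), and the READ-OUT `goodLift_model_case_iff` : «`α ↦ toD(α)` bijective»
  ↔ `LiftsAll …` ∧ `RigidOverBase (D.goodLocalFrobenioidOfEmb p k ι hX).toBase` — the latter VERBATIM the `hker` input of abc-iut-L5-t4's T5
  `Cor53.goodLocalFrobenioidOfEmb_descend…` (p495336); `goodLift_model_case_of_hker_of_liftsAll`;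
* §3 AT THE TERM (racer C's §0 place plumbing `specAt/primeAt/finPlaceAt`, `frobeniusGoodAt`, `isOpen_PiXarrow_of_mergeInputs`, all BY NAME):
  `localToGF_injective_at`, the seam `localDataOfBadPairs_H_at` (abc-iut-L5-t4 `localDatumAt_H`/`localGroupAt_of_not_mem`/`decompAt_of_indexCopyVal_eq_non`),
  **`goodStructureFunctorAt : (D.frobeniusGoodAt CG hA B I x hx).Cv ⥤ CosetCat ↥Π_v̲`** (type-checks DEFINITIONALLY against C's carrier — slot law
  (S1) by construction), **`GoodLiftFAmbAt` / `goodLiftToDAt`** (the `FAmb x` / `toD x` of record at a good nonarchimedean `x`; `goodLiftToDAt_obj` rfl)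
  and **`goodLiftAt_model_case_iff`**: bijective ↔ `LiftsAll` ∧ `RigidOverBase (D.frobeniusGoodAt CG hA B I x hx).toBase`.

BINDER CENSUS (§3): kit binders {CG, hS, M, hA, hI, B, ΛBad} ∪ {I : MergeInputs B} ∪ DATA {x, hx : x ∉ V̲^arc, hxb : x ∉ V̲^bad}; displayed INPUTS of
the read-out = the two named PREDICATES `LiftsAll` (print's surjectivity half, «Π_{C_F}-induced» lifts — functoriality of the construction in
transporters, NOT proved here) and `RigidOverBase` (print's injectivity half = the rigidity rows' conclusion, NOT proved here); FACT unnamed 0;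
LAW 0; 0 instance · 0 notation · no new `Prop` fact (the [cite] on `compactSpace_gal_algebraicClosure` is Mathlib's profinite-Galois instance
read at `k̄/k`).  Universe: `F K Fbar : Type` as the winner's term (RULING #1 (5)).  HONEST FRAMING: an `ℱ`-slot over OUR Π-avatar kit is OUR object;
«bijective ↔ two named halves» is a READ-OUT, not a discharge; typed ≠ inhabited ≠ proved; nothing here asserts abc proved or refuted.
-/

noncomputable section

namespace Literature.IUT.HodgeTheaters

open CategoryTheory Literature.AnabelianGeometry.SemiGraphs

/-! ### §0. The injectivity half is invariant under post-composing the structure functor with an equivalence of bases -/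

namespace CatIsomorphism

universe v₁ v₂ v₃ u₁ u₂ u₃

variable {C : Type u₁} [Category.{v₁} C] {B : Type u₂} [Category.{v₂} B] {B' : Type u₃} [Category.{v₃} B']

/-- **`RigidOverBase` is invariant under an equivalence of bases**: a self-equivalence of `C` lies under the identity of `B`
through `p` iff it lies under the identity of `B'` through `p ⋙ E` (whisker with `E`, resp. with `E⁻¹` and the unit), so the
injectivity half of Cor 5.3 (ii) read at a structure functor transported along `E : B ≌ B'` is the one read at `p` itself.
([IUTchI] Cor 5.3 (ii) p.144) [claim: Mochizuki2012, status: disputed] -/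
theorem rigidOverBase_comp_equivalence_iff (p : C ⥤ B) (E : B ≌ B') : RigidOverBase (p ⋙ E.functor) ↔ RigidOverBase p := by
  constructor
  · rintro h Ψ ⟨i⟩
    refine h Ψ ⟨?_⟩
    exact (Functor.associator _ _ _).symm ≪≫ Functor.isoWhiskerRight (i ≪≫ p.rightUnitor) E.functor ≪≫
      (p ⋙ E.functor).rightUnitor.symm
  · rintro h Ψ ⟨i⟩
    refine h Ψ ⟨?_⟩
    have j : (Ψ.functor ⋙ p) ⋙ E.functor ≅ p ⋙ E.functor :=
      Functor.associator _ _ _ ≪≫ i ≪≫ (p ⋙ E.functor).rightUnitor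
    exact (Ψ.functor ⋙ p).rightUnitor.symm ≪≫ Functor.isoWhiskerLeft (Ψ.functor ⋙ p) E.unitIso ≪≫
      (Functor.associator _ _ _).symm ≪≫ Functor.isoWhiskerRight j E.inverse ≪≫ Functor.associator _ _ _ ≪≫
      Functor.isoWhiskerLeft p E.unitIso.symm ≪≫ p.rightUnitor ≪≫ p.rightUnitor.symm

end CatIsomorphism

/-! ### §1. The homeomorphism `Π_{(−)_v̲} = Π_{(−)} ×_{G_F} Γ ≃ₜ* Π_{(−)} ∩ augGF⁻¹(ρ(Γ))` and the induced equivalence of coset categories -/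

namespace InitialThetaData

section PiLocTop

universe u v

variable {F : Type u} {K : Type v} {Fbar : Type} [Field F] [NumberField F] [Field K] [NumberField K]
  [Algebra F K] [Field Fbar] [Algebra F Fbar] [Algebra K Fbar]
  {E : WeierstrassCurve F} [E.IsElliptic] {l : ℕ} {Pb : BadPlacePredicates K}
  (D : InitialThetaData F K Fbar E l Pb) (H : Subgroup D.PiC)
  {Γ : Type} [Group Γ] [TopologicalSpace Γ] (ρ : Γ →* (Fbar ≃ₐ[F] Fbar))

/-- **`Π_{(−)_v̲} ≅ Π_{(−)} ∩ augGF⁻¹(ρ(Γ))` EXPLICITLY** (the multiplicative equivalence inside abc-iut-L5-t2's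
`nonempty_mulEquiv_PiLoc_inf`: first projection, injective when `ρ` is): Def 3.1 (e) «injections of profinite groups».
([IUTchI] Def 3.1 (e) p.62) [claim: Mochizuki2012, status: disputed] -/
def piLocEquiv (hρ : Function.Injective ρ) : D.PiLoc H ρ ≃* ↥(H ⊓ ρ.range.comap D.augGF) :=
  (MonoidHom.ofInjective (D.fstLoc_injective H ρ hρ)).trans (MulEquiv.subgroupCongr (D.range_fstLoc H ρ))

omit [TopologicalSpace Γ] in
/-- `piLocEquiv` is the first projection on underlying elements. ([IUTchI] Def 3.1 (e) p.62) [claim: Mochizuki2012, status: disputed] -/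
@[simp] theorem coe_piLocEquiv (hρ : Function.Injective ρ) (z : D.PiLoc H ρ) :
    ((D.piLocEquiv H ρ hρ z : ↥(H ⊓ ρ.range.comap D.augGF)) : D.PiC) = z.1.1 := rfl

/-- `piLocEquiv` is continuous (it is the first projection). ([IUTchI] Def 3.1 (e) p.62) [claim: Mochizuki2012, status: disputed] -/
theorem continuous_piLocEquiv (hρ : Function.Injective ρ) : Continuous (D.piLocEquiv H ρ hρ) := by
  refine continuous_induced_rng.2 ?_
  have h : (Subtype.val ∘ fun z => D.piLocEquiv H ρ hρ z) = fun z => z.1.1 := funext fun z => D.coe_piLocEquiv H ρ hρ z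
  rw [h]
  exact continuous_fst.comp continuous_subtype_val

/-- The inverse of `piLocEquiv` is continuous when `Π_{(−)}` is open, `ρ` continuous and `Γ` compact (`Π_{(−)_v̲}` is then compact,
abc-iut-L5-t2 `compactSpace_PiLoc`, and a continuous bijection from a compact space to a Hausdorff one is a homeomorphism) — so
`piLocEquiv` is an isomorphism of topological groups. ([IUTchI] Def 3.1 (e) p.62) [claim: Mochizuki2012, status: disputed] -/
theorem continuous_piLocEquiv_symm [CompactSpace Γ] (hX : IsOpen (H : Set D.PiC)) (hρc : Continuous ρ)
    (hρ : Function.Injective ρ) : Continuous (D.piLocEquiv H ρ hρ).symm := by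
  haveI := D.compactSpace_PiLoc H ρ hX hρc
  exact Continuous.continuous_symm_of_equiv_compact_to_t2 (f := (D.piLocEquiv H ρ hρ).toEquiv) (D.continuous_piLocEquiv H ρ hρ)

/-- **`ℬ(Π_{(−)_v̲})⁰ ≌ ℬ(Π_{(−)} ∩ augGF⁻¹(ρ(Γ)))⁰` as small coset categories**: transport along the homeomorphic group isomorphism
`piLocEquiv` (racer B `PiTransport.pullEquivOfInverse`; [FrdII] Ex 1.3 (ii)). ([IUTchI] Def 3.1 (e) p.62) [claim: Mochizuki2012, status: disputed] -/
def cosetCatPiLocEquiv [CompactSpace Γ] (hX : IsOpen (H : Set D.PiC)) (hρc : Continuous ρ) (hρ : Function.Injective ρ) :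
    CosetCat (D.PiLoc H ρ) ≌ CosetCat ↥(H ⊓ ρ.range.comap D.augGF) :=
  PiTransport.pullEquivOfInverse (D.piLocEquiv H ρ hρ).symm.toMonoidHom (D.piLocEquiv H ρ hρ).toMonoidHom
    (D.continuous_piLocEquiv_symm H ρ hX hρc hρ) (D.continuous_piLocEquiv H ρ hρ)
    (MonoidHom.ext fun x => (D.piLocEquiv H ρ hρ).symm_apply_apply x)
    (MonoidHom.ext fun x => (D.piLocEquiv H ρ hρ).apply_symm_apply x)

end PiLocTop

end InitialThetaData

/-! ### §2. THE (S1) UPGRADE: the lift-kind `ℱ`-slot of the kit of record at a good nonarchimedean index over the GENUINE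
`𝒞_v̲ = (D.goodLocalFrobenioidOfEmb p k ι hX).Cv` ([IUTchI] Ex 3.3 (i)–(ii) for `D`), and the Cor 5.3 (ii) model case READ OUT -/

section GalCompact

/-- The absolute Galois group of a field `k` of characteristic zero containing `ℚ_p` is compact for the Krull topology
(Mathlib's profinite-Galois instance at the Galois extension `k̄/k`). [cite: NeukirchANT1999, Ch. IV §1 (profinite Galois groups)] -/
theorem compactSpace_gal_algebraicClosure (p : ℕ) [Fact p.Prime] (k : Type) [Field k] [Algebra ℚ_[p] k] :
    CompactSpace (AlgebraicClosure k ≃ₐ[k] AlgebraicClosure k) := by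
  haveI : CharZero k := charZero_of_injective_algebraMap (algebraMap ℚ_[p] k).injective
  infer_instance

end GalCompact

section GoodSlot

open InitialThetaData

variable {F K Fbar : Type} [Field F] [NumberField F] [Field K] [NumberField K] [Algebra F K]
  [Field Fbar] [Algebra F Fbar] [Algebra K Fbar] [IsScalarTower F K Fbar] [Normal K Fbar]
  {E : WeierstrassCurve F} [E.IsElliptic] {l : ℕ} {Pb : BadPlacePredicates K}
  (D : InitialThetaData F K Fbar E l Pb) (CG : D.geom.pe.CuspGalois) (hS : D.CuspClassesNormaliserStable) [Fact l.Prime]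
  (M : D.TorsionMonodromy) (hA : D.geom.pe.ArrowCoveringClaims)
  (hI : ∀ k ∈ D.geom.pe.inertia D.geom.pe.ε1, M.tau (D.geom.embK k) = 0)
  (B : ∀ v, v ∈ D.indexCopyBad → D.BadPairAt v) (ΛBad : ∀ v (h : v ∈ D.indexCopyBad), D.LocalArrowLaw CG hS (B v h).H)
  (p : ℕ) [Fact p.Prime] (k : Type) [NontriviallyNormedField k] [CompleteSpace k] [IsUltrametricDist k]
  [NormedAlgebra ℚ_[p] k] [FiniteDimensional ℚ_[p] k] [Algebra K k] (ι : Fbar →ₐ[K] AlgebraicClosure k)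
  (hinj : Function.Injective (localToGF F k ι)) (hX : IsOpen (D.PiXarrow : Set D.PiC)) (x : D.IndexCopy)
  (hG : (D.localDataOfBadPairs CG hS M hA hI B ΛBad x).H = D.PiXarrow ⊓ (localToGF F k ι).range.comap D.augGF)

namespace InitialThetaData

omit [IsScalarTower F K Fbar] [Normal K Fbar] in
/-- **The good-index seam**: at an index `x ∉ V̲^bad` the kit of record's `Π_v̲` is `Π_{X̲→_K} ∩ augGF⁻¹ G_v̲` (abc-iut-L5-t4
`localDatumAt_H`, `localGroupAt_of_not_mem`). ([IUTchI] Def 3.1 (f) p.63) [claim: Mochizuki2012, status: disputed] -/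
theorem localDataOfBadPairs_H_of_not_mem_bad (hxb : x ∉ D.indexCopyBad) :
    (D.localDataOfBadPairs CG hS M hA hI B ΛBad x).H = D.PiXarrow ⊓ (D.decompAt x).comap D.augGF := by
  rw [D.localDatumAt_H, D.localGroupAt_of_not_mem B hxb]

include p hinj hX hG

/-- **The base seam at a good index**: `𝒟_v̲ = ℬ(Π_v̲)⁰` of the genuine `𝒞_v̲` (`CosetCat (Π_{X̲→_K} ×_{G_F} Gal(k̄/k))`, abc-iut-L5-t2
`goodLocalFrobenioidOfEmb`) ≌ the coset category of the kit of record's embedded `Π_v̲` — the homeomorphism `piLocEquiv` of §1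
followed by the equality `hG` of subgroups (racer B `PiTransport.cosetCatEquivOfEq`). ([IUTchI] Def 3.1 (e)(f) p.62) [claim: Mochizuki2012, status: disputed] -/
def goodBaseEquiv : CosetCat (D.PiLoc D.PiXarrow (localToGF F k ι)) ≌ CosetCat ↥((D.localDataOfBadPairs CG hS M hA hI B ΛBad x).H) :=
  haveI := Literature.IUT.HodgeTheaters.compactSpace_gal_algebraicClosure p k
  (D.cosetCatPiLocEquiv D.PiXarrow (localToGF F k ι) hX (continuous_localToGF F k ι) hinj).trans
    (PiTransport.cosetCatEquivOfEq hG.symm)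

/-- **The structure functor of the genuine `𝒞_v̲` READ OVER the kit's `Π_v̲`**: `toBase` of abc-iut-L5-t2's
`D.goodLocalFrobenioidOfEmb p k ι hX` ([IUTchI] Ex 3.3 (i): «`ℱ̲_v := 𝒞_v` … base category `𝒟_v`») followed by the base seam.
([IUTchI] Ex 3.3 (i) p.78) [claim: Mochizuki2012, status: disputed] -/
def goodStructureFunctor :
    letI := GaloisValDatum.normVal k
    (D.goodLocalFrobenioidOfEmb p k ι hX).Cv ⥤ CosetCat ↥((D.localDataOfBadPairs CG hS M hA hI B ΛBad x).H) :=
  letI := GaloisValDatum.normVal k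
  (D.goodLocalFrobenioidOfEmb p k ι hX).toBase ⋙ (D.goodBaseEquiv CG hS M hA hI B ΛBad p k ι hinj hX x hG).functor

/-- **THE LIFT GROUP AT A GOOD INDEX**: `Aut_{Amb}(𝒟_v̲) ×_{Aut(ℬ(Π_v̲)⁰)} Aut(𝒞_v̲)` — pairs (transporter automorphism of the kit's `𝒟_v̲`,
§0-isomorphism of the GENUINE `𝒞_v̲` lying over it) (racer B `CatIsomorphism.liftSubgroup` with `ρ_x = modelAutToCatAut`).
([IUTchI] Def 5.2 (i) p.134) [claim: Mochizuki2012, status: disputed] -/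
def goodLiftSubgroup :
    Subgroup (Aut ((D.baseKitThetaNFOfBadPairs CG hS M hA hI B ΛBad).model x) ×
      (letI := GaloisValDatum.normVal k; CatAut (D.goodLocalFrobenioidOfEmb p k ι hX).Cv)) :=
  letI := GaloisValDatum.normVal k
  CatIsomorphism.liftSubgroup (D.goodStructureFunctor CG hS M hA hI B ΛBad p k ι hinj hX x hG)
    ((D.baseKitThetaNFOfBadPairs CG hS M hA hI B ΛBad).model x) (D.modelAutToCatAut CG hS M hA hI B ΛBad x)

/-- **THE (S1) SLOT `FAmb x`**: the one-object kind of the genuine `𝒞_v̲` placed over the kit's ambient — `SingleObj` of the lift group.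
Its unique object IS (the kind of) `𝒞_v̲ = (D.goodLocalFrobenioidOfEmb p k ι hX).Cv` (slot law (S1) by construction).
([IUTchI] Def 5.2 (i) p.134) [claim: Mochizuki2012, status: disputed] -/
abbrev GoodLiftFAmb : Type := SingleObj ↥(D.goodLiftSubgroup CG hS M hA hI B ΛBad p k ι hinj hX x hG)

/-- **THE (S1) SLOT `toD x`**: `𝔉 ↦ 𝔇` on the lift kind = first projection into the kit's ambient (Rmk 5.2.1 (i)).
([IUTchI] Rmk 5.2.1 (i) p.143) [claim: Mochizuki2012, status: disputed] -/
def goodLiftToD :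
    D.GoodLiftFAmb CG hS M hA hI B ΛBad p k ι hinj hX x hG ⥤ (D.baseKitThetaNFOfBadPairs CG hS M hA hI B ΛBad).Amb x :=
  letI := GaloisValDatum.normVal k
  CatIsomorphism.liftKindToAmb (D.goodStructureFunctor CG hS M hA hI B ΛBad p k ι hinj hX x hG)
    ((D.baseKitThetaNFOfBadPairs CG hS M hA hI B ΛBad).model x) (D.modelAutToCatAut CG hS M hA hI B ΛBad x)

/-- **(S5) at the upgraded slot is DEFINITIONAL**: `toD x` sends the reference object to the kit's own model `𝒟_v̲` on the nose, so
`toD_model x := Iso.refl _`. ([IUTchI] Rmk 5.2.1 (i) p.143) [claim: Mochizuki2012, status: disputed] -/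
theorem goodLiftToD_obj (X : D.GoodLiftFAmb CG hS M hA hI B ΛBad p k ι hinj hX x hG) :
    (D.goodLiftToD CG hS M hA hI B ΛBad p k ι hinj hX x hG).obj X = (D.baseKitThetaNFOfBadPairs CG hS M hA hI B ΛBad).model x :=
  rfl

/-- **[IUTchI] Cor 5.3 (ii), MODEL CASE AT THE UPGRADED GOOD SLOT, READ OUT.**  The hypothesis of abc-iut-L5-t4's
`FKit.isomFtoDBijective_of_model` at this index — «`α ↦ toD(α)` bijective on automorphisms of the reference object» — holds IFF
(a) `LiftsAll`: every Π_{C_F}-transporter automorphism of the kit's `𝒟_v̲` has a §0-isomorphism of the GENUINE `𝒞_v̲` over it (the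
surjectivity half of the argument printed for (iv) «from the construction», transposed; HERE the functoriality of abc-iut-L5-t2's `goodLocalFrobenioidOfEmb` in transporters — a named
PREDICATE, labelled «Π_{C_F}-induced»), AND (b) `RigidOverBase (𝒞_v̲).toBase`: every self-equivalence of the genuine `𝒞_v̲` lying under the
identity of ITS OWN base `ℬ(Π_v̲)⁰` is `≅ 𝟭` — VERBATIM the `hker` input of abc-iut-L5-t4's T5 `Cor53.goodLocalFrobenioidOfEmb_descend…`
(p495336), i.e. the conclusion the [FrdI]-level rigidity rows (L1-t7 S2′ ∘ S2c) deliver.  No tautology; no binder beyond the kit's,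
the place data {p, k, ι, hinj, hX} and the seam equation `hG`. ([IUTchI] Cor 5.3 (ii) p.144) [claim: Mochizuki2012, status: disputed] -/
theorem goodLift_model_case_iff :
    letI := GaloisValDatum.normVal k
    Function.Bijective (fun α : SingleObj.star ↥(D.goodLiftSubgroup CG hS M hA hI B ΛBad p k ι hinj hX x hG) ≅
        SingleObj.star ↥(D.goodLiftSubgroup CG hS M hA hI B ΛBad p k ι hinj hX x hG) =>
        (show (D.baseKitThetaNFOfBadPairs CG hS M hA hI B ΛBad).model x ≅ (D.baseKitThetaNFOfBadPairs CG hS M hA hI B ΛBad).model x from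
          (D.goodLiftToD CG hS M hA hI B ΛBad p k ι hinj hX x hG).mapIso α)) ↔
      CatIsomorphism.LiftsAll (D.goodStructureFunctor CG hS M hA hI B ΛBad p k ι hinj hX x hG)
          ((D.baseKitThetaNFOfBadPairs CG hS M hA hI B ΛBad).model x) (D.modelAutToCatAut CG hS M hA hI B ΛBad x) ∧
        CatIsomorphism.RigidOverBase (D.goodLocalFrobenioidOfEmb p k ι hX).toBase := by
  letI := GaloisValDatum.normVal k
  rw [← CatIsomorphism.rigidOverBase_comp_equivalence_iff (D.goodLocalFrobenioidOfEmb p k ι hX).toBase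
    (D.goodBaseEquiv CG hS M hA hI B ΛBad p k ι hinj hX x hG)]
  exact CatIsomorphism.mapIso_liftKindToAmb_bijective_iff'

/-- The same with the injectivity input spelled as abc-iut-L5-t4's `hker` and the surjectivity input as `LiftsAll` — the two DISPLAYED
halves give the model case at the upgraded slot. ([IUTchI] Cor 5.3 (ii) p.144) [claim: Mochizuki2012, status: disputed] -/
theorem goodLift_model_case_of_hker_of_liftsAll
    (hker : letI := GaloisValDatum.normVal k
      ∀ Ψ : (D.goodLocalFrobenioidOfEmb p k ι hX).Cv ≌ (D.goodLocalFrobenioidOfEmb p k ι hX).Cv,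
      Nonempty (CatIsomorphism.LiesUnder (D.goodLocalFrobenioidOfEmb p k ι hX).toBase
        (D.goodLocalFrobenioidOfEmb p k ι hX).toBase Ψ
        (CategoryTheory.Equivalence.refl (C := CosetCat (D.PiLoc D.PiXarrow (localToGF F k ι))))) →
      Nonempty (Ψ.functor ≅ 𝟭 (D.goodLocalFrobenioidOfEmb p k ι hX).Cv))
    (hlift : letI := GaloisValDatum.normVal k
      CatIsomorphism.LiftsAll (D.goodStructureFunctor CG hS M hA hI B ΛBad p k ι hinj hX x hG)
        ((D.baseKitThetaNFOfBadPairs CG hS M hA hI B ΛBad).model x) (D.modelAutToCatAut CG hS M hA hI B ΛBad x)) :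
    letI := GaloisValDatum.normVal k
    Function.Bijective (fun α : SingleObj.star ↥(D.goodLiftSubgroup CG hS M hA hI B ΛBad p k ι hinj hX x hG) ≅
        SingleObj.star ↥(D.goodLiftSubgroup CG hS M hA hI B ΛBad p k ι hinj hX x hG) =>
        (show (D.baseKitThetaNFOfBadPairs CG hS M hA hI B ΛBad).model x ≅ (D.baseKitThetaNFOfBadPairs CG hS M hA hI B ΛBad).model x from
          (D.goodLiftToD CG hS M hA hI B ΛBad p k ι hinj hX x hG).mapIso α)) :=
  (D.goodLift_model_case_iff CG hS M hA hI B ΛBad p k ι hinj hX x hG).2 ⟨hlift, hker⟩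

end InitialThetaData

end GoodSlot

/-! ### §3. AT THE WINNER'S TERM: the (S1) upgrade over racer C's `frobeniusGoodAt CG hA B I x hx` (`genuineFKitOfBadLocal`, p496697) -/

section AtTerm

open InitialThetaData _root_.NumberField _root_.IsDedekindDomain Literature.NumberTheory.NumberFields

variable {F K Fbar : Type} [Field F] [NumberField F] [Field K] [NumberField K] [Algebra F K]
  [Field Fbar] [Algebra F Fbar] [Algebra K Fbar]
  {E : WeierstrassCurve F} [E.IsElliptic] {l : ℕ} {Pb : BadPlacePredicates K}
  (D : InitialThetaData F K Fbar E l Pb)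

namespace InitialThetaData

/-- `K_v̲ := K_w` rescaled (abc-iut-S7 `RescaledCompletion`) at the nonarchimedean index `x` — racer C's §0 plumbing `specAt/primeAt`.
([IUTchI] Ex 3.3 (i) p.78) [claim: Mochizuki2012, status: disputed] -/
abbrev KvAt (x : D.IndexCopy) (hx : x ∉ D.indexCopyArc) : Type :=
  RescaledCompletion K (D.primeAt x hx) (D.specAt x hx) (D.primeAt_mem x hx)

/-- The `K`-algebra structure of `K_v̲` (that of the completion `K_w`, as in abc-iut-L5-t2's `goodLocalFrobenioidAt`).
([IUTchI] Ex 3.3 (i) p.78) [claim: Mochizuki2012, status: disputed] -/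
abbrev algebraKvAt (x : D.IndexCopy) (hx : x ∉ D.indexCopyArc) : Algebra K (D.KvAt x hx) :=
  inferInstanceAs (Algebra K ((D.specAt x hx).adicCompletion K))

/-- The restriction `Gal(K̄_v̲/K_v̲) → G_F` at the index is injective (Krasner density, abc-iut-L5-t2 `localToGF_injective_adicCompletion`).
([IUTchI] Def 3.1 (e) p.62) [claim: Mochizuki2012, status: disputed] -/
theorem localToGF_injective_at (x : D.IndexCopy) (hx : x ∉ D.indexCopyArc) :
    haveI := D.isScalarTower
    haveI := D.normal_K
    letI := D.algebraKvAt x hx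
    Function.Injective (localToGF F (D.KvAt x hx) (localEmb (K := K) (Fbar := Fbar) (AlgebraicClosure (D.KvAt x hx)))) := by
  haveI := D.isScalarTower
  haveI := D.normal_K
  haveI := D.isAlgClosure
  haveI : IsAlgClosed Fbar := IsAlgClosure.isAlgClosed F
  exact localToGF_injective_adicCompletion (D.specAt x hx) _ F

variable (CG : D.geom.pe.CuspGalois) (hS : D.CuspClassesNormaliserStable) [Fact l.Prime]
  (M : D.TorsionMonodromy) (hA : D.geom.pe.ArrowCoveringClaims)
  (hI : ∀ k ∈ D.geom.pe.inertia D.geom.pe.ε1, M.tau (D.geom.embK k) = 0)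
  (B : ∀ v, v ∈ D.indexCopyBad → D.BadPairAt v) (ΛBad : ∀ v (h : v ∈ D.indexCopyBad), D.LocalArrowLaw CG hS (B v h).H)

/-- **The seam equation at a good nonarchimedean index of the kit of record**: `Π_v̲` of the local datum IS
`Π_{X̲→_K} ∩ augGF⁻¹(G_w)` with `G_w` the image of `Gal(K̄_w/K_w)`, `K_w = K_v̲` (abc-iut-L5-t4 `localDatumAt_H`/`localGroupAt_of_not_mem`,
`decompAt_of_indexCopyVal_eq_non`; racer C `indexCopyVal_eq_inr`). ([IUTchI] Def 3.1 (e)(f) p.62) [claim: Mochizuki2012, status: disputed] -/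
theorem localDataOfBadPairs_H_at (x : D.IndexCopy) (hx : x ∉ D.indexCopyArc) (hxb : x ∉ D.indexCopyBad) :
    haveI := D.isScalarTower
    haveI := D.normal_K
    letI := D.algebraKvAt x hx
    (D.localDataOfBadPairs CG hS M hA hI B ΛBad x).H =
      D.PiXarrow ⊓ (localToGF F (D.KvAt x hx) (localEmb (K := K) (Fbar := Fbar) (AlgebraicClosure (D.KvAt x hx)))).range.comap D.augGF := by
  rw [D.localDataOfBadPairs_H_of_not_mem_bad CG hS M hA hI B ΛBad x hxb, D.decompAt_of_indexCopyVal_eq_non (D.indexCopyVal_eq_inr x hx)]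
  rfl

variable (I : D.MergeInputs B) (x : D.IndexCopy) (hx : x ∉ D.indexCopyArc) (hxb : x ∉ D.indexCopyBad) [Fact (D.primeAt x hx).Prime]

/-- **(S1) — THE UPGRADED SLOT'S FROBENIOID IS RACER C's `frobeniusGoodAt`**: the structure functor of §2 at the index data
(`K_v̲`, `localEmb`, `hX` from `I`) HAS SOURCE `(D.frobeniusGoodAt CG hA B I x hx).Cv` — definitionally (this declaration type-checks by
unfolding abc-iut-L5-t2's `goodLocalFrobenioidAt`). ([IUTchI] Ex 3.3 (i) p.78) [claim: Mochizuki2012, status: disputed] -/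
def goodStructureFunctorAt :
    letI := GaloisValDatum.normVal (D.KvAt x hx)
    (D.frobeniusGoodAt CG hA B I x hx).Cv ⥤ CosetCat ↥((D.localDataOfBadPairs CG hS M hA hI B ΛBad x).H) :=
  haveI := D.isScalarTower
  haveI := D.normal_K
  letI := D.algebraKvAt x hx
  haveI := GaloisValDatum.finiteDimensional_rescaledCompletion K (D.primeAt x hx) (D.specAt x hx) (D.primeAt_mem x hx)
  D.goodStructureFunctor CG hS M hA hI B ΛBad (D.primeAt x hx) (D.KvAt x hx)
    (localEmb (K := K) (Fbar := Fbar) (AlgebraicClosure (D.KvAt x hx))) (D.localToGF_injective_at x hx)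
    (D.isOpen_PiXarrow_of_mergeInputs CG hA B I) x (D.localDataOfBadPairs_H_at CG hS M hA hI B ΛBad x hx hxb)

/-- **THE (S1) SLOT OF RECORD AT THE TERM — `FAmb x`** (good nonarchimedean `x`): the lift kind of racer C's `frobeniusGoodAt` over the
kit's `𝒟_v̲`. ([IUTchI] Def 5.2 (i) p.134) [claim: Mochizuki2012, status: disputed] -/
abbrev GoodLiftFAmbAt : Type :=
  letI := GaloisValDatum.normVal (D.KvAt x hx)
  SingleObj ↥(CatIsomorphism.liftSubgroup (D.goodStructureFunctorAt CG hS M hA hI B ΛBad I x hx hxb)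
    ((D.baseKitThetaNFOfBadPairs CG hS M hA hI B ΛBad).model x) (D.modelAutToCatAut CG hS M hA hI B ΛBad x))

/-- **THE (S1) SLOT OF RECORD AT THE TERM — `toD x`** (first projection into the kit's ambient).
([IUTchI] Rmk 5.2.1 (i) p.143) [claim: Mochizuki2012, status: disputed] -/
def goodLiftToDAt : D.GoodLiftFAmbAt CG hS M hA hI B ΛBad I x hx hxb ⥤ (D.baseKitThetaNFOfBadPairs CG hS M hA hI B ΛBad).Amb x :=
  letI := GaloisValDatum.normVal (D.KvAt x hx)
  CatIsomorphism.liftKindToAmb (D.goodStructureFunctorAt CG hS M hA hI B ΛBad I x hx hxb)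
    ((D.baseKitThetaNFOfBadPairs CG hS M hA hI B ΛBad).model x) (D.modelAutToCatAut CG hS M hA hI B ΛBad x)

/-- **(S5) at the term, DEFINITIONAL**: `toD_model x := Iso.refl _`. ([IUTchI] Rmk 5.2.1 (i) p.143) [claim: Mochizuki2012, status: disputed] -/
theorem goodLiftToDAt_obj (X : D.GoodLiftFAmbAt CG hS M hA hI B ΛBad I x hx hxb) :
    (D.goodLiftToDAt CG hS M hA hI B ΛBad I x hx hxb).obj X = (D.baseKitThetaNFOfBadPairs CG hS M hA hI B ΛBad).model x := rfl

/-- **[IUTchI] Cor 5.3 (ii), MODEL CASE AT THE (S1) SLOT OF THE TERM, READ OUT**: bijective IFF `LiftsAll` (Π_{C_F}-transporters of the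
kit's `𝒟_v̲` lift to §0-isomorphisms of `frobeniusGoodAt`) ∧ `RigidOverBase (D.frobeniusGoodAt CG hA B I x hx).toBase` (abc-iut-L5-t4's `hker`
at the genuine place).  Binders: the kit's ∪ {I, x, hx, hxb}; inputs DISPLAYED as the two named predicates; nothing asserted.
([IUTchI] Cor 5.3 (ii) p.144) [claim: Mochizuki2012, status: disputed] -/
theorem goodLiftAt_model_case_iff :
    letI := GaloisValDatum.normVal (D.KvAt x hx)
    Function.Bijective (fun α : SingleObj.star _ ≅ SingleObj.star _ =>
        (show (D.baseKitThetaNFOfBadPairs CG hS M hA hI B ΛBad).model x ≅ (D.baseKitThetaNFOfBadPairs CG hS M hA hI B ΛBad).model x from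
          (D.goodLiftToDAt CG hS M hA hI B ΛBad I x hx hxb).mapIso α)) ↔
      CatIsomorphism.LiftsAll (D.goodStructureFunctorAt CG hS M hA hI B ΛBad I x hx hxb)
          ((D.baseKitThetaNFOfBadPairs CG hS M hA hI B ΛBad).model x) (D.modelAutToCatAut CG hS M hA hI B ΛBad x) ∧
        CatIsomorphism.RigidOverBase (D.frobeniusGoodAt CG hA B I x hx).toBase := by
  haveI := D.isScalarTower
  haveI := D.normal_K
  letI := D.algebraKvAt x hx
  haveI := GaloisValDatum.finiteDimensional_rescaledCompletion K (D.primeAt x hx) (D.specAt x hx) (D.primeAt_mem x hx)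
  exact D.goodLift_model_case_iff CG hS M hA hI B ΛBad (D.primeAt x hx) (D.KvAt x hx)
    (localEmb (K := K) (Fbar := Fbar) (AlgebraicClosure (D.KvAt x hx))) (D.localToGF_injective_at x hx)
    (D.isOpen_PiXarrow_of_mergeInputs CG hA B I) x (D.localDataOfBadPairs_H_at CG hS M hA hI B ΛBad x hx hxb)

end InitialThetaData

end AtTerm

end Literature.IUT.HodgeTheaters

end
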